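import Summits.QuantumFields.QCD.Theorems.QuarksAsStableActionStableActionBridgeGaugeKernelBounds
import Summits.QuantumFields.QCD.Theorems.QuarksAsStableActionStableActionBridgeFermionSliceContinuous
import Literature.MathematicalPhysics.QuantumFieldTheory.WilsonTorusTransferMatrix
import HarnessLib

/-!
# The Gauss-averaged gauge bond kernel is jointly continuous
(stub `stub_bondKernel_continuous` of line `twisted_trace_transfer` for crux
`QuarksAsStableAction.StableActionBridge`, item stmt-QuantumFields-9737, §8 E3, sub-goal B3)

Lüscher's QCD transfer matrix is realised (E3) as an `L²` integral operator whose kernel contains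
the Gauss-averaged gauge bond kernel

  `B(U, U')_{s s'} = ∫ K_β(U, U'^g) Γ(G_g)_{s s'} dg`,

the integral running over the temporal links `g : TorusSite 3 S → SU(3)` against the product Haar
probability measure; `K_β = gaugeSliceKernel β` is the Wilson pure-gauge transfer kernel in temporal
gauge, `U'^g = gaugeTransform g U'`, and `Γ(G_g) = fockGaugeAct g` is the action of the gauge
rotation on the slice Fock space.  This file proves that `(U, U') ↦ B(U, U')_{s s'}` is jointly
continuous.

Proof.  The integrand `((U, U'), g) ↦ K_β(U, U'^g) · Γ(G_g)_{s s'}` is jointly continuous on the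
COMPACT space `(SU(3)^E × SU(3)^E) × SU(3)^{sites}`:
* `K_β` is jointly continuous (`Sketch.continuous_gaugeSliceKernel`) and `(g, U') ↦ U'^g` is
  jointly continuous (`continuous_gaugeTransform_prod`);
* `g ↦ Γ(G_g)` is continuous: `G_g = sliceGaugeRot g = sliceKron (block-diagonal matrix of entries
  of the `g x`) 1`, whose entries are entries of the continuous coordinate maps `g ↦ g x`
  (`FermionSliceContinuous.continuous_sliceKron`), and the Fock functor `Γ = fockLift` is a matrix
  of minors, continuous (`FermionSliceContinuous.continuous_fockLift`).
Hence the integrand is bounded by a constant `C` (compactness), each section is (strongly)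
measurable (continuity; `SU(3)` is second countable, so the finite product carries its Borel
structure), and dominated convergence with the constant dominating function on the probability
space of temporal links (`MeasureTheory.continuous_of_dominated`) gives continuity of the
parametric integral.  [folklore]

Theorems only; helper lemmas live in the sub-namespace `StubBondKernelContinuous`.  The local
notation `𝔾 = SU(3)` is the file-local notation of `QCDTransferMatrix.lean` (no library notation
is shadowed); it is kept so that the stub statement is the registered one verbatim.
-/

noncomputable section

open MeasureTheory Filter
open scoped InnerProductSpace ComplexConjugate Matrix BigOperators
open Literature.MathematicalPhysics.QuantumFieldTheory Literature.MathematicalPhysics.QuantumLattice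

namespace Summit.QuantumFields.QCD.Cruxes.StableActionBridge.TwistedTraceTransfer

local notation "𝔾" => Matrix.specialUnitaryGroup (Fin 3) ℂ

open Literature.Probability.LatticeModels (TorusSite)

namespace StubBondKernelContinuous

variable {Nf S : ℕ}

/-- **The one-particle gauge rotation `g ↦ G_g = sliceGaugeRot g` is continuous** in the temporal
links `g : sites → SU(3)`: every entry is `0` or an entry of some `g x`. [folklore] -/
theorem continuous_sliceGaugeRot :
    Continuous fun g : TorusSite 3 S → 𝔾 => sliceGaugeRot (Nf := Nf) g := by
  unfold sliceGaugeRot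
  refine Sketch.FermionSliceContinuous.continuous_sliceKron ?_ 1
  refine continuous_matrix fun p q => ?_
  have hentry : Continuous fun g : TorusSite 3 S → 𝔾 =>
      (g p.2.1 : Matrix (Fin 3) (Fin 3) ℂ) p.2.2 q.2.2 :=
    (continuous_apply p.2.1).subtype_val.matrix_elem p.2.2 q.2.2
  simp only [Matrix.of_apply]
  exact hentry.if_const _ continuous_const

/-- **The Fock-space gauge action `g ↦ Γ(G_g) = fockGaugeAct g` is continuous** (the Fock functor
`Γ` is a matrix of minors of the continuous `G_g`). [folklore] -/
theorem continuous_fockGaugeAct [NeZero S] :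
    Continuous fun g : TorusSite 3 S → 𝔾 => fockGaugeAct (Nf := Nf) g := by
  unfold fockGaugeAct
  exact Sketch.FermionSliceContinuous.continuous_fockLift
    (continuous_sliceGaugeRot.matrix_reindex _ _)

/-- `((U, U'), g) ↦ U'^g` is jointly continuous (from `continuous_gaugeTransform_prod`). [folklore] -/
theorem continuous_gaugeTransform_snd [NeZero S] :
    Continuous fun z : (GaugeConfig 3 S 𝔾 × GaugeConfig 3 S 𝔾) × (TorusSite 3 S → 𝔾) =>
      gaugeTransform z.2 z.1.2 := by
  have hgt : Continuous fun q : (TorusSite 3 S → 𝔾) × GaugeConfig 3 S 𝔾 => gaugeTransform q.1 q.2 :=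
    continuous_gaugeTransform_prod
  fun_prop

/-- `((U, U'), g) ↦ K_β(U, U'^g)` is jointly continuous. [folklore] -/
theorem continuous_gaugeSliceKernel_gaugeTransform [NeZero S] (β : ℝ) :
    Continuous fun z : (GaugeConfig 3 S 𝔾 × GaugeConfig 3 S 𝔾) × (TorusSite 3 S → 𝔾) =>
      gaugeSliceKernel β z.1.1 (gaugeTransform z.2 z.1.2) := by
  have hK : Continuous fun p : GaugeConfig 3 S 𝔾 × GaugeConfig 3 S 𝔾 => gaugeSliceKernel β p.1 p.2 :=
    Sketch.continuous_gaugeSliceKernel S β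
  have hT := continuous_gaugeTransform_snd (S := S)
  fun_prop

/-- **Joint continuity of the bond integrand** `((U, U'), g) ↦ K_β(U, U'^g) · Γ(G_g)_{s s'}` on
`(SU(3)^E × SU(3)^E) × SU(3)^{sites}`. [folklore] -/
theorem continuous_bondIntegrand [NeZero S] (β : ℝ) (s s' : Finset (SliceFermiIdx Nf S)) :
    Continuous fun z : (GaugeConfig 3 S 𝔾 × GaugeConfig 3 S 𝔾) × (TorusSite 3 S → 𝔾) =>
      (gaugeSliceKernel β z.1.1 (gaugeTransform z.2 z.1.2) : ℂ) * fockGaugeAct (Nf := Nf) z.2 s s' := by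
  have hK := continuous_gaugeSliceKernel_gaugeTransform (S := S) β
  have hΓ := (continuous_fockGaugeAct (Nf := Nf) (S := S)).comp
    (continuous_snd :
      Continuous fun z : (GaugeConfig 3 S 𝔾 × GaugeConfig 3 S 𝔾) × (TorusSite 3 S → 𝔾) => z.2)
  have hF := hΓ.matrix_elem s s'
  have hKc := Complex.continuous_ofReal.comp hK
  exact hKc.mul hF

end StubBondKernelContinuous

open StubBondKernelContinuous

/-- **Sub-goal B3 (stub `stub_bondKernel_continuous`): the Gauss-averaged gauge bond kernel
`B(U, U')_{s s'} = ∫ K_β(U, U'^g) Γ(G_g)_{s s'} dg` is jointly continuous in `(U, U')`**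
(parametric integral over the compact group of temporal links of the jointly continuous, hence
bounded, integrand `K_β(U, U'^g) Γ(G_g)_{s s'}`; dominated convergence with a constant dominating
function on the product Haar probability space). [folklore] -/
theorem stub_bondKernel_continuous : ∀ (Nf S : ℕ) [NeZero S] (β : ℝ) (s s' : Finset (SliceFermiIdx Nf S)),
    Continuous fun p : GaugeConfig 3 S 𝔾 × GaugeConfig 3 S 𝔾 =>
      ∫ g : TorusSite 3 S → 𝔾, (gaugeSliceKernel β p.1 (gaugeTransform g p.2) : ℂ) * fockGaugeAct (Nf := Nf) g s s'
        ∂(Measure.pi fun _ => haarProbability 𝔾) := by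
  intro Nf S _ β s s'
  haveI : SecondCountableTopology (Matrix (Fin 3) (Fin 3) ℂ) :=
    inferInstanceAs (SecondCountableTopology (Fin 3 → Fin 3 → ℂ))
  haveI : SecondCountableTopology 𝔾 := Topology.IsEmbedding.subtypeVal.secondCountableTopology
  have hFc := continuous_bondIntegrand (Nf := Nf) (S := S) β s s'
  obtain ⟨C, hC⟩ := isCompact_univ.exists_bound_of_continuousOn hFc.continuousOn
  have hmeas : ∀ p : GaugeConfig 3 S 𝔾 × GaugeConfig 3 S 𝔾,
      AEStronglyMeasurable (fun g : TorusSite 3 S → 𝔾 =>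
        (gaugeSliceKernel β p.1 (gaugeTransform g p.2) : ℂ) * fockGaugeAct (Nf := Nf) g s s')
        (Measure.pi fun _ => haarProbability 𝔾) := fun p => by
    have h := hFc.comp (Continuous.prodMk_right p)
    exact h.aestronglyMeasurable
  have hcont : ∀ g : TorusSite 3 S → 𝔾, Continuous fun p : GaugeConfig 3 S 𝔾 × GaugeConfig 3 S 𝔾 =>
      (gaugeSliceKernel β p.1 (gaugeTransform g p.2) : ℂ) * fockGaugeAct (Nf := Nf) g s s' :=
    fun g => by
    have h := hFc.comp (Continuous.prodMk_left g)
    exact h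
  have hbd : ∀ (p : GaugeConfig 3 S 𝔾 × GaugeConfig 3 S 𝔾) (g : TorusSite 3 S → 𝔾),
      ‖(gaugeSliceKernel β p.1 (gaugeTransform g p.2) : ℂ) * fockGaugeAct (Nf := Nf) g s s'‖ ≤ C :=
    fun p g => hC (p, g) (Set.mem_univ _)
  exact continuous_of_dominated
    (F := fun (p : GaugeConfig 3 S 𝔾 × GaugeConfig 3 S 𝔾) (g : TorusSite 3 S → 𝔾) =>
      (gaugeSliceKernel β p.1 (gaugeTransform g p.2) : ℂ) * fockGaugeAct (Nf := Nf) g s s')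
    (bound := fun _ => C) hmeas (fun p => Eventually.of_forall fun g => hbd p g) (integrable_const C)
    (Eventually.of_forall hcont)

end Summit.QuantumFields.QCD.Cruxes.StableActionBridge.TwistedTraceTransfer

end
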